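import Mathlib
import HarnessLib
import Literature.MathematicalPhysics.QuantumLattice.AngularCutoffFrechetBounds
import Literature.MathematicalPhysics.QuantumLattice.SectorProductSymbolDecay

/-!
# The scale-`0` ANGULAR factor `ζ̃_{0,ω}(θ(p⃗))` made globally smooth: a radial plateau times the sector weight, its agreement with the sector
# weight off the unit disc, and GLOBAL bounds on its first three Fréchet derivatives

Topic `MathematicalPhysics/QuantumLattice`; continues `AngularCutoffFrechetBounds` (p4: `‖Dⁱ[ζ̃_{0,ω}∘θ](P)‖ ≤ B·((1+N!)/r₀)ⁱ` for
`‖P‖ ≥ r₀ > 0`) and `SectorProductSymbolDecay` (p3: `radialCutoffC r (momToComplex k)·ζ̃(θ(k))` is smooth on all of `ℝ²`).  In the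
scale-`0` sector multipliers `F_ω(k) = C₀⁻¹(√(k₀² + e_K(k⃗)²))·ζ̃_{0,ω}(θ(k⃗))` of Benfatto–Giuliani–Mastropietro 2006 (§2.5 (2.45)–(2.48)) the
angular factor is read only on the shell `|e_K| < e₀`, where `‖c⃗(k⃗)‖ ≥ 1` (`μ ≥ −1.05`); replacing it by the plateau product
`Ã_ω = radialCutoffC 1 ∘ momToComplex · ζ̃_{0,ω}∘θ` (equal to it for `‖P‖ ≥ 1`, smooth everywhere) lets the telescoped space-moment
machinery (`HubbardSymbolCentredComposition`, which needs a globally smooth factor with global derivative bounds) run: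

* `scaleZeroAngular ω` and `scaleZeroAngular_eq_of_le` (`= ζ̃_{0,ω}(θ(P))` for `‖P‖ ≥ 1`), `scaleZeroAngular_eventuallyEq` (`‖P‖ > 1`),
  `abs_scaleZeroAngular_le_one`, `contDiff_scaleZeroAngular`;
* **`exists_norm_iteratedFDeriv_scaleZeroAngular_le`** — `∃ C ≥ 0, ∀ i ≤ 3, ∀ P, ‖Dⁱ Ã_ω(P)‖ ≤ C` (compactness on the closed unit
  ball, p4's bound outside).

Everything is proved; `scaleZeroAngular` is the only definition; no named facts.

## Sources

G. Benfatto, A. Giuliani, V. Mastropietro, Ann. Henri Poincaré 7 (2006) 809–898, §2.5 (2.45)–(2.48), Lemma 2.2 (2.36aa)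
(`BenfattoGiulianiMastropietro2006`).
-/

noncomputable section

namespace Literature.MathematicalPhysics.QuantumLattice

open Real Set Filter Literature.Analysis.SpecialFunctions
open scoped Nat Topology

/-- **The smoothed scale-`0` angular factor**: `Ã_ω(P) = radialCutoffC 1 (P) · ζ̃_{0,ω}(θ(P))` (the plateau is `0` on `‖P‖ ≤ ½`, `1` on
`‖P‖ ≥ 1`). [cite: BenfattoGiulianiMastropietro2006, §2.5 (2.45)] -/
def scaleZeroAngular (ω : ℤ) (P : EuclideanSpace ℝ (Fin 2)) : ℝ :=
  radialCutoffC 1 (momToComplex (WithLp.ofLp P)) * sectorWeightCirc 0 ω (polarAngle (WithLp.ofLp P))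

/-- Off the unit disc the smoothed factor IS the angular factor. [cite: BenfattoGiulianiMastropietro2006, §2.5 (2.45)] -/
theorem scaleZeroAngular_eq_of_le (ω : ℤ) {P : EuclideanSpace ℝ (Fin 2)} (hP : 1 ≤ ‖P‖) :
    scaleZeroAngular ω P = sectorWeightCirc 0 ω (polarAngle (WithLp.ofLp P)) := by
  rw [scaleZeroAngular, radialCutoffC_eq_one one_pos (by rwa [norm_momToComplex_ofLp]), one_mul]

/-- Near a point with `‖P‖ > 1` the smoothed factor agrees with the angular factor. [cite: BenfattoGiulianiMastropietro2006, §2.5 (2.45)] -/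
theorem scaleZeroAngular_eventuallyEq (ω : ℤ) {P : EuclideanSpace ℝ (Fin 2)} (hP : 1 < ‖P‖) :
    scaleZeroAngular ω =ᶠ[𝓝 P] fun P => sectorWeightCirc 0 ω (polarAngle (WithLp.ofLp P)) := by
  have hopen : IsOpen {Q : EuclideanSpace ℝ (Fin 2) | 1 < ‖Q‖} := isOpen_lt continuous_const continuous_norm
  filter_upwards [hopen.mem_nhds hP] with Q hQ
  exact scaleZeroAngular_eq_of_le ω (le_of_lt hQ)

/-- `|Ã_ω| ≤ 1`. [cite: BenfattoGiulianiMastropietro2006, §2.5 (2.45)] -/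
theorem abs_scaleZeroAngular_le_one (ω : ℤ) (P : EuclideanSpace ℝ (Fin 2)) : |scaleZeroAngular ω P| ≤ 1 := by
  rw [scaleZeroAngular, abs_mul]
  have h1 := radialCutoffC_mem_Icc 1 (momToComplex (WithLp.ofLp P))
  have h2 := sectorWeightCirc_nonneg 0 ω (polarAngle (WithLp.ofLp P))
  have h3 := sectorWeightCirc_le_one 0 ω (polarAngle (WithLp.ofLp P))
  rw [abs_of_nonneg h1.1, abs_of_nonneg h2]
  nlinarith [h1.1, h1.2]

/-- `P ↦ ofLp P` is smooth (coordinatewise a continuous linear map). [cite: BenfattoGiulianiMastropietro2006, §2.5 (2.45)] -/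
theorem contDiff_ofLp_euclidean {n : WithTop ℕ∞} : ContDiff ℝ n (fun P : EuclideanSpace ℝ (Fin 2) => (WithLp.ofLp P : Fin 2 → ℝ)) :=
  contDiff_pi.2 fun i => (PiLp.proj 2 (fun _ : Fin 2 => ℝ) i : EuclideanSpace ℝ (Fin 2) →L[ℝ] ℝ).contDiff

/-- **The smoothed factor is smooth on all of the plane.** [cite: BenfattoGiulianiMastropietro2006, §2.5 Lemma 2.2] -/
theorem contDiff_scaleZeroAngular (ω : ℤ) {n : ℕ∞} : ContDiff ℝ n (scaleZeroAngular ω) :=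
  (contDiff_radial_mul_sectorWeightCirc_polarAngle one_pos 0 ω (m := n)).comp contDiff_ofLp_euclidean

/-- **Global bounds on the first three derivatives of the smoothed factor**: `∃ C ≥ 0, ∀ i ≤ 3, ∀ P, ‖DⁱÃ_ω(P)‖ ≤ C` — on the closed unit
ball by compactness (the factor is smooth), outside by p4's angular Fréchet bound at `r₀ = 1`. [cite: BenfattoGiulianiMastropietro2006, §2.5 Lemma 2.2] -/
theorem exists_norm_iteratedFDeriv_scaleZeroAngular_le (ω : ℤ) :
    ∃ C : ℝ, 0 ≤ C ∧ ∀ i ≤ 3, ∀ P : EuclideanSpace ℝ (Fin 2), ‖iteratedFDeriv ℝ i (scaleZeroAngular ω) P‖ ≤ C := by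
  -- outside the closed unit ball
  obtain ⟨B, hB0, hB⟩ := exists_norm_iteratedFDeriv_sectorWeightCirc_zero_polarAngle_le 3
  -- on the closed unit ball: continuity of each derivative on a compact set
  have hball : IsCompact (Metric.closedBall (0 : EuclideanSpace ℝ (Fin 2)) 1) := isCompact_closedBall 0 1
  have hcont : ∀ i : ℕ, Continuous fun P => iteratedFDeriv ℝ i (scaleZeroAngular ω) P := fun i =>
    (contDiff_scaleZeroAngular ω (n := i)).continuous_iteratedFDeriv le_rfl
  have hin : ∀ i : ℕ, ∃ Ci : ℝ, 0 ≤ Ci ∧ ∀ P ∈ Metric.closedBall (0 : EuclideanSpace ℝ (Fin 2)) 1,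
      ‖iteratedFDeriv ℝ i (scaleZeroAngular ω) P‖ ≤ Ci := by
    intro i
    obtain ⟨Ci, hCi⟩ := hball.exists_bound_of_continuousOn (hcont i).continuousOn
    exact ⟨max Ci 0, le_max_right _ _, fun P hP => (hCi P hP).trans (le_max_left _ _)⟩
  obtain ⟨C0, hC00, hC0⟩ := hin 0
  obtain ⟨C1, hC10, hC1⟩ := hin 1
  obtain ⟨C2, hC20, hC2⟩ := hin 2
  obtain ⟨C3, hC30, hC3⟩ := hin 3
  refine ⟨C0 + C1 + C2 + C3 + B * ((1 + (3 !)) / 1) ^ 3, by positivity, fun i hi P => ?_⟩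
  have hout : 1 < ‖P‖ → ‖iteratedFDeriv ℝ i (scaleZeroAngular ω) P‖ ≤ B * ((1 + (3 !)) / 1) ^ 3 := by
    intro hP
    rw [((scaleZeroAngular_eventuallyEq ω hP).iteratedFDeriv ℝ i).eq_of_nhds]
    have h := hB i hi ω P one_pos hP.le
    refine h.trans (mul_le_mul_of_nonneg_left ?_ hB0)
    exact pow_le_pow_right₀ (by norm_num [Nat.factorial]) hi
  by_cases hP : ‖P‖ ≤ 1
  · have hPm : P ∈ Metric.closedBall (0 : EuclideanSpace ℝ (Fin 2)) 1 := by simpa using hP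
    have hB3 : 0 ≤ B * ((1 + (3 !)) / 1) ^ 3 := by positivity
    interval_cases i
    · linarith [hC0 P hPm]
    · linarith [hC1 P hPm]
    · linarith [hC2 P hPm]
    · linarith [hC3 P hPm]
  · linarith [hout (lt_of_not_ge hP)]

end Literature.MathematicalPhysics.QuantumLattice

end
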